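import Literature.MathematicalPhysics.QuantumFieldTheory.Balaban1983to89.Node00.OpsYOfLetters
import Literature.MathematicalPhysics.QuantumFieldTheory.Balaban1983to89.B9Eq3132ScalarIndex

/-!
# `Balaban1983to89.B9Eq3132RingInverseReading` — [B9] (3.132) p. 422: the blockwise un-normalising dictionary of the N06 knit's
# row 26 is a THEOREM for every letter of the form `U ↦ Ring.inverse (T U)` (real matrix in the product basis, «operator norm of a
# block ≤ κ · Σ |entries|»); row 26 at the record from the four estimate binders only

T. Bałaban, *Propagators for lattice gauge theories in a background field*, Commun. Math. Phys. **99** (1985) 389–434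
[`Balaban1985BackgroundPropagators`, "B9"]; [4] = T. Bałaban, *Propagators and renormalization transformations for lattice
gauge theories. II*, Commun. Math. Phys. **96** (1984) 223–250 [`Balaban1984PropagatorsII`].

statement-level skeleton of published theorems with citation tags; proofs where landed; nothing here is a claim about the
Yang–Mills mass gap

THE PRINTED LOCUS (verbatim, p. 422 [PDF 34]).  *"We have |(QGQ\*)^{−1}(y, y′)| ≤ O(1)(L^jη)^{−2}(L^{j′}η)^{−d}e^{−δ₁d(y,y′)} for
y ∈ Λ_j, y′ ∈ Λ_{j′}, (3.132) and the same for the operator with G₁ instead of G."*  (QGQ\*)^{−1}(y, y′) ∈ End(𝔤), |·| the operator norm.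

THE POINT.  In the N06 knit at def-Y's instance (`BalabanUVNodesN06AtOpsYOfLettersAllPinsB`, p477264) row 26 is displayed through
`B9Eq3132Whole.InvNormalised` ∕ `B9Eq3132ScalarIndex.InvNormalisedIdx` (p462308, p475370): *the (3.132) READING of the letter
`(𝔏 x).QGQinv` — `Node00.siteKernelOfOp`, `sup_{‖E‖≤1} ‖(K(U)(δ_{y′} ⊗ E))(y)‖` — is dominated blockwise by the inverse of a normalised
real matrix `S x U` on the scalar index `𝔅 × basis(𝔤)`* — a located HYPOTHESIS, because v1's letters are arbitrary.  def-Y's v2 builds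
every inverse letter as `Ring.inverse` of a constructed operator (`Node00.OpsYDeltaPrimeA.GpY`, memo §7: `GA`, `C`, `QGQinv`, …).  For
letters of that form the dictionary is finite-dimensional linear algebra, and THIS FILE proves it once for all `T`:

* §1 `piBasisY b` — the real product basis `δ_x ⊗ b_f` of `X → 𝔸` from a real basis `b : Module.Basis Ff ℝ 𝔸`; `reMatY b T` — the REAL
  MATRIX of a ℂ-linear letter `T : (X → 𝔸) →ₗ[ℂ] (X → 𝔸)` (restriction of scalars); multiplicative, `reMatY_ringInverse` (unit case),
  `apply_deltaY_eq` (the block entry `(T(δ_{x′} ⊗ E))(x)` in coordinates).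
* §2 `dimConstY b = ‖b.equivFunL‖·Σ_f ‖b_f‖` and ★ `norm_apply_deltaY_le`: `‖(T(δ_{x′} ⊗ E))(x)‖ ≤ κ(b)·‖E‖·Σ_{f,f′}|reMatY b T (x,f) (x′,f′)|`
  (operator norm of a block ≤ κ · sum of its scalar entries); ★ `norm_ringInverse_deltaY_le` — the same for `Ring.inverse T` against
  `(reMatY b T)⁻¹` in BOTH cases (`T` a unit: inverse matrix; not a unit: `Ring.inverse T = 0`).
* §3 `siteKernelOfOp_ker_ringInverse_le` — def-Y's (3.48)∕(3.132)∕(3.187) reading of `U ↦ Ring.inverse (T U)` through any `ix, iy` is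
  `≤ κ(b)·Σ` over the two basis fibres of the inverse real matrix; `normMatY b w T := diag(w∘fst∕κ′)·reMatY b T·diag(w∘fst)` (the written
  repair's `S̃` on `I = 𝔅 × basis(𝔤)`, `κ′ = max κ 1`), `normMatY_inv_apply`; ★ `invNormalisedIdx_of_ringInverse` — `InvNormalisedIdx` for the
  reading at the index bonds, `π := Prod.fst`, EVERY positive weight `w`, NO hypothesis on `T`.
* §4 ★ `stmt3132Printed_geo9Y_of_ringInverse` — ROW 26 AT THE RECORD GEOMETRY for `U ↦ Ring.inverse (T x U)`, `U ↦ Ring.inverse (T₁ x U)`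
  from the FOUR ESTIMATE BINDERS ONLY (`B9Eq3132CTInputs.CoerciveUnder ∕ DecayUnder` of the normalised real matrices on the index, symmetric
  weights `(Lʲη)^{−(1+d′∕2)}`), over `B9Eq3132ScalarIndex.stmt3132Printed_geo9Y_of_coercive_decay_idx` with `hN hN₁ π hF` discharged.
* §5 ★ `stmt3132Printed_opsYOfLetters_of_ringInverse` — the same at `opsYOfLetters N θ M⋆ 𝔏 𝔈` under `hT : ∀ x U, (𝔏 x).QGQinv U =
  Ring.inverse (T x U)` (+ `hT₁`): the knit's `s3132` with the dictionary binders GONE (at def-Y v2's letters `hT` is by construction).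

HONEST SCOPE.  Nothing of print is asserted: the ESTIMATES (Thm 3.11-type coercivity and Thm 3.3-type decay of the normalised (QGQ\*)(U),
(QG₁Q\*)(U), located p. 416 ∕ p. 399 + [4] (2.60)) REMAIN HYPOTHESES; what is proved is the dictionary between an inverse operator on
`𝔸`-valued lattice functions and a finite real matrix, with an explicit basis constant.  Kernel-checked bookkeeping — NOT a node discharge,
NOT summit progress; one finite lattice programme; nothing continuum, nothing about the mass gap.  Cell `pub-ymgap` (HUMAN RULING D-0062),
Track A node N06 [B9], N06-ASSIGNMENT v1 row 26 (bundle F4), seat `pub-ymgap-dag-n06-i` gen 4, 2026-08-27.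
-/

namespace Literature.MathematicalPhysics.QuantumFieldTheory.Balaban1983to89.B9Eq3132RingInverseReading

open Node00 (deltaY BallY siteKernelOfOp iSup_ball_le CfgY IBondY)
open scoped Matrix

noncomputable section

/-! ## §1 The real matrix of a ℂ-linear letter on `𝔸`-valued functions -/

section RealMatrix

variable {𝔸 : Type} [NormedRing 𝔸] [NormedAlgebra ℂ 𝔸]
variable {X : Type} [Fintype X] [DecidableEq X] {Ff : Type} [Fintype Ff] [DecidableEq Ff]
variable (b : Module.Basis Ff ℝ 𝔸)

/-- the REAL PRODUCT BASIS `δ_x ⊗ b_f` of the `𝔸`-valued functions on a finite carrier, from a real basis `b` of `𝔸`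
(the written repair's scalar index set `I = 𝔅 × basis(𝔤)`). [cite: Balaban1985BackgroundPropagators, (3.132) p.422 (𝔤-valued kernels read on a basis; dictionary)] -/
def piBasisY : Module.Basis (X × Ff) ℝ (X → 𝔸) :=
  (Pi.basis fun _ : X => b).reindex (Equiv.sigmaEquivProd X Ff)

omit [DecidableEq X] [Fintype Ff] [DecidableEq Ff] in
/-- coordinates in the product basis are the `b`-coordinates of the values. [cite: Balaban1985BackgroundPropagators, (3.132) p.422, bookkeeping] -/
theorem piBasisY_repr (Φ : X → 𝔸) (p : X × Ff) : (piBasisY (X := X) b).repr Φ p = b.repr (Φ p.1) p.2 := by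
  unfold piBasisY
  rw [Module.Basis.repr_reindex_apply]
  rfl

omit [Fintype Ff] [DecidableEq Ff] in
/-- the basis vectors are the product-form deltas `δ_x ⊗ b_f`. [cite: Balaban1985BackgroundPropagators, (3.132) p.422, bookkeeping] -/
theorem piBasisY_apply (p : X × Ff) : piBasisY (X := X) b p = deltaY p.1 (b p.2) := by
  unfold piBasisY
  rw [Module.Basis.reindex_apply]
  funext z
  change (Pi.basis fun _ : X => b) ⟨p.1, p.2⟩ z = _
  rw [Pi.basis_apply]
  simp [deltaY, Pi.single_apply]

/-- **THE REAL MATRIX OF A ℂ-LINEAR LETTER** `T : (X → 𝔸) →ₗ[ℂ] (X → 𝔸)` in the product basis `δ_x ⊗ b_f` (restriction of scalars to ℝ).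
[cite: Balaban1985BackgroundPropagators, (3.132) p.422 (the End(𝔤)-valued kernel as a real matrix on 𝔅 × basis(𝔤); dictionary)] -/
def reMatY (T : (X → 𝔸) →ₗ[ℂ] (X → 𝔸)) : Matrix (X × Ff) (X × Ff) ℝ :=
  LinearMap.toMatrix (piBasisY b) (piBasisY b) (T.restrictScalars ℝ)

/-- the real matrix is multiplicative. [cite: Balaban1985BackgroundPropagators, (3.132) p.422, bookkeeping] -/
theorem reMatY_mul (T T' : (X → 𝔸) →ₗ[ℂ] (X → 𝔸)) : reMatY b (T * T') = reMatY b T * reMatY b T' := by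
  unfold reMatY
  rw [← LinearMap.toMatrix_mul]
  congr 1

/-- the real matrix of the identity letter is `1`. [cite: Balaban1985BackgroundPropagators, (3.132) p.422, bookkeeping] -/
theorem reMatY_one : reMatY (X := X) b 1 = 1 := by
  unfold reMatY
  rw [← LinearMap.toMatrix_id (v₁ := piBasisY (X := X) b)]
  congr 1

/-- for a UNIT letter the real matrix of `Ring.inverse T` is the matrix inverse. [cite: Balaban1985BackgroundPropagators, (3.126) p.420 + (3.132) p.422 (the inverse operator; dictionary)] -/
theorem reMatY_ringInverse {T : (X → 𝔸) →ₗ[ℂ] (X → 𝔸)} (hT : IsUnit T) :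
    reMatY b (Ring.inverse T) = (reMatY b T)⁻¹ := by
  obtain ⟨u, rfl⟩ := hT
  rw [Ring.inverse_unit]
  symm
  apply Matrix.inv_eq_left_inv
  rw [← reMatY_mul, Units.inv_mul, reMatY_one]

/-- coordinates of `TΦ`: `b.repr ((TΦ)(x)) f = Σ_p reMatY (x,f) p · b.repr (Φ p.1) p.2`. [cite: Balaban1985BackgroundPropagators, (3.132) p.422, bookkeeping] -/
theorem repr_apply_eq (T : (X → 𝔸) →ₗ[ℂ] (X → 𝔸)) (Φ : X → 𝔸) (x : X) (f : Ff) :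
    b.repr (T Φ x) f = ∑ p : X × Ff, reMatY b T (x, f) p * b.repr (Φ p.1) p.2 := by
  have h := LinearMap.toMatrix_mulVec_repr (piBasisY (X := X) b) (piBasisY (X := X) b) (T.restrictScalars ℝ) Φ
  have hx := congrFun h (x, f)
  rw [piBasisY_repr] at hx
  change _ = b.repr (T Φ x) f at hx
  rw [← hx, Matrix.mulVec, dotProduct]
  refine Finset.sum_congr rfl fun p _ => ?_
  rw [piBasisY_repr]
  rfl

/-- **THE BLOCK ENTRY OF A LETTER ON A DELTA**: `(T(δ_{x′} ⊗ E))(x) = Σ_f (Σ_{f′} reMatY (x,f) (x′,f′)·b.repr E f′) • b_f`.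
[cite: Balaban1985BackgroundPropagators, (3.132) p.422 (kernel entry = block of the real matrix; dictionary)] -/
theorem apply_deltaY_eq (T : (X → 𝔸) →ₗ[ℂ] (X → 𝔸)) (x x' : X) (E : 𝔸) :
    T (deltaY x' E) x = ∑ f : Ff, (∑ f' : Ff, reMatY b T (x, f) (x', f') * b.repr E f') • b f := by
  conv_lhs => rw [← b.sum_repr (T (deltaY x' E) x)]
  refine Finset.sum_congr rfl fun f _ => ?_
  congr 1
  rw [repr_apply_eq, Fintype.sum_prod_type]
  rw [Finset.sum_eq_single x']
  · refine Finset.sum_congr rfl fun f' _ => ?_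
    simp [deltaY]
  · intro x'' _ hne
    apply Finset.sum_eq_zero
    intro f' _
    simp [deltaY, hne]
  · intro h; exact absurd (Finset.mem_univ x') h

end RealMatrix

/-! ## §2 The dimension constant and the block bound «operator norm of a block ≤ κ(b) · Σ |entries|» -/

section BlockBound

variable {𝔸 : Type} [NormedRing 𝔸] [NormedAlgebra ℂ 𝔸]
variable {X : Type} [Fintype X] [DecidableEq X] {Ff : Type} [Fintype Ff] [DecidableEq Ff]
variable (b : Module.Basis Ff ℝ 𝔸)

/-- **THE DIMENSION CONSTANT OF A REAL BASIS OF `𝔸`**: `κ(b) := ‖coordinate map‖ · Σ_f ‖b_f‖` (the written repair §4.5: *"passing to the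
scalar index set … costs a factor n_𝔤"* — here the honest finite-dimensional constant of the chosen basis and norm).
[cite: Balaban1985BackgroundPropagators, (3.132) p.422 (|·| = operator norm on 𝔤; dictionary)] -/
def dimConstY : ℝ := ‖(b.equivFunL : 𝔸 →L[ℝ] (Ff → ℝ))‖ * ∑ f : Ff, ‖b f‖

omit [DecidableEq Ff] in
/-- `0 ≤ κ(b)`. [cite: Balaban1985BackgroundPropagators, (3.132) p.422, bookkeeping] -/
theorem dimConstY_nonneg : 0 ≤ dimConstY b :=
  mul_nonneg (norm_nonneg _) (Finset.sum_nonneg fun _ _ => norm_nonneg _)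

omit [DecidableEq Ff] in
/-- a coordinate is bounded by the coordinate map's norm: `|b.repr E f| ≤ ‖b.equivFunL‖ · ‖E‖`. [cite: Balaban1985BackgroundPropagators, (3.132) p.422, bookkeeping (finite-dimensional norms)] -/
theorem abs_repr_le (E : 𝔸) (f : Ff) : |b.repr E f| ≤ ‖(b.equivFunL : 𝔸 →L[ℝ] (Ff → ℝ))‖ * ‖E‖ := by
  have h1 : |b.repr E f| ≤ ‖(b.equivFunL : 𝔸 →L[ℝ] (Ff → ℝ)) E‖ := by
    have h := norm_le_pi_norm ((b.equivFunL : 𝔸 →L[ℝ] (Ff → ℝ)) E) f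
    rw [Real.norm_eq_abs] at h
    convert h using 2
    simp
  exact h1.trans (ContinuousLinearMap.le_opNorm _ E)

/-- ★ **THE OPERATOR NORM OF A BLOCK IS AT MOST `κ(b)` TIMES THE SUM OF ITS SCALAR ENTRIES**: for every ℂ-linear letter `T` on
`𝔸`-valued functions, `‖(T(δ_{x′} ⊗ E))(x)‖ ≤ κ(b)·‖E‖·Σ_{f,f′} |reMatY b T (x,f) (x′,f′)|`.
[cite: Balaban1985BackgroundPropagators, (3.132) p.422 (End(𝔤)-valued kernel entries in operator norm; dictionary)] -/
theorem norm_apply_deltaY_le (T : (X → 𝔸) →ₗ[ℂ] (X → 𝔸)) (x x' : X) (E : 𝔸) :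
    ‖T (deltaY x' E) x‖ ≤ dimConstY b * ‖E‖ * ∑ f : Ff, ∑ f' : Ff, |reMatY b T (x, f) (x', f')| := by
  set φ : ℝ := ‖(b.equivFunL : 𝔸 →L[ℝ] (Ff → ℝ))‖ with hφ
  set B : ℝ := ∑ g : Ff, ‖b g‖ with hB
  have hφ0 : 0 ≤ φ := norm_nonneg _
  have hB0 : 0 ≤ B := Finset.sum_nonneg fun _ _ => norm_nonneg _
  have hE0 : 0 ≤ ‖E‖ := norm_nonneg _
  rw [apply_deltaY_eq b T x x' E]
  calc ‖∑ f : Ff, (∑ f' : Ff, reMatY b T (x, f) (x', f') * b.repr E f') • b f‖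
      ≤ ∑ f : Ff, ‖(∑ f' : Ff, reMatY b T (x, f) (x', f') * b.repr E f') • b f‖ := norm_sum_le _ _
    _ = ∑ f : Ff, |∑ f' : Ff, reMatY b T (x, f) (x', f') * b.repr E f'| * ‖b f‖ := by
        refine Finset.sum_congr rfl fun f _ => ?_
        rw [norm_smul, Real.norm_eq_abs]
    _ ≤ ∑ f : Ff, (∑ f' : Ff, |reMatY b T (x, f) (x', f')| * (φ * ‖E‖)) * B := by
        refine Finset.sum_le_sum fun f _ => ?_
        refine mul_le_mul ?_ (Finset.single_le_sum (fun g _ => norm_nonneg (b g)) (Finset.mem_univ f)) (norm_nonneg _) ?_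
        · refine (Finset.abs_sum_le_sum_abs _ _).trans (Finset.sum_le_sum fun f' _ => ?_)
          rw [abs_mul]
          exact mul_le_mul_of_nonneg_left (abs_repr_le b E f') (abs_nonneg _)
        · exact Finset.sum_nonneg fun f' _ => mul_nonneg (abs_nonneg _) (mul_nonneg hφ0 hE0)
    _ = dimConstY b * ‖E‖ * ∑ f : Ff, ∑ f' : Ff, |reMatY b T (x, f) (x', f')| := by
        rw [dimConstY, ← hφ, ← hB, Finset.mul_sum]
        refine Finset.sum_congr rfl fun f _ => ?_
        simp only [Finset.sum_mul, Finset.mul_sum]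
        refine Finset.sum_congr rfl fun f' _ => ?_
        ring

/-- ★ **THE SAME FOR AN INVERSE LETTER `Ring.inverse T` AGAINST THE INVERSE REAL MATRIX** — both cases: if `T` is a unit its inverse has real
matrix `(reMatY b T)⁻¹`; if not, `Ring.inverse T = 0` and the bound is trivial.
[cite: Balaban1985BackgroundPropagators, (3.126) p.420 + (3.132) p.422 (the operator (QGQ*)⁻¹ and its kernel; dictionary)] -/
theorem norm_ringInverse_deltaY_le (T : (X → 𝔸) →ₗ[ℂ] (X → 𝔸)) (x x' : X) (E : 𝔸) :
    ‖(Ring.inverse T) (deltaY x' E) x‖ ≤ dimConstY b * ‖E‖ * ∑ f : Ff, ∑ f' : Ff, |(reMatY b T)⁻¹ (x, f) (x', f')| := by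
  by_cases hT : IsUnit T
  · rw [← reMatY_ringInverse b hT]
    exact norm_apply_deltaY_le b (Ring.inverse T) x x' E
  · rw [Ring.inverse_non_unit _ hT, LinearMap.zero_apply, Pi.zero_apply, norm_zero]
    exact mul_nonneg (mul_nonneg (dimConstY_nonneg b) (norm_nonneg _))
      (Finset.sum_nonneg fun _ _ => Finset.sum_nonneg fun _ _ => abs_nonneg _)

end BlockBound

/-! ## §3 The (3.48)∕(3.132)∕(3.187) reading of an inverse letter, the normalised real matrix, and the blockwise dictionary -/

section Reading

open B6KLevelCensusIndexV1 (KIdx)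
open B9Eq3132ScalarIndex (InvNormalisedIdx)

variable {d ℓ : ℕ} {hd : 1 ≤ d + 1} {hL : Odd (ℓ + 1) ∧ 1 < ℓ + 1} {b₀ b₁ : ℝ}
variable {𝔸 : Type} [NormedRing 𝔸] [NormedAlgebra ℂ 𝔸] [CompleteSpace 𝔸]
variable {Ff : Type} [Fintype Ff] [DecidableEq Ff] (b : Module.Basis Ff ℝ 𝔸)
variable {X : Type} [Fintype X] [DecidableEq X]

omit [Fintype Ff] [DecidableEq Ff] [Fintype X] [DecidableEq X] in
/-- the reading `sup_{‖E‖ ≤ 1} ‖(O(U)(δ_{y′} ⊗ E))(y)‖` is non-negative. [cite: Balaban1985BackgroundPropagators, (3.132) p.422, bookkeeping] -/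
theorem siteKernelOfOp_ker_nonneg (i : KIdx d ℓ hd hL b₀ b₁) (B : B9.Backgrounds) (cfg : B.Cfg → CfgY 𝔸 i) {Y : Type}
    (O : CfgY 𝔸 i → (Y → 𝔸) →ₗ[ℂ] (X → 𝔸)) (ix : IBondY i → X) (iy : IBondY i → Y) (U : B.Cfg) (c c' : IBondY i) :
    0 ≤ (siteKernelOfOp i B cfg O ix iy).ker U c c' :=
  Real.iSup_nonneg fun _ => norm_nonneg _

/-- **THE READING OF AN INVERSE LETTER IS DOMINATED BY THE BASIS-BLOCK OF THE INVERSE REAL MATRIX**: for every letter family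
`T : CfgY → End_ℂ(X → 𝔸)` and coarse points read through `ix`, `iy`,
`(siteKernelOfOp B cfg (U ↦ Ring.inverse (T U)) ix iy).ker U c c′ ≤ κ(b)·Σ_{f,f′} |(reMatY b (T (cfg U)))⁻¹ (ix c, f) (iy c′, f′)|`.
[cite: Balaban1985BackgroundPropagators, (3.48) p.398, (3.132) p.422, (3.187) p.432 (the inverse-operator kernels; dictionary)] -/
theorem siteKernelOfOp_ker_ringInverse_le (i : KIdx d ℓ hd hL b₀ b₁) (B : B9.Backgrounds) (cfg : B.Cfg → CfgY 𝔸 i)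
    (T : CfgY 𝔸 i → Module.End ℂ (X → 𝔸)) (ix iy : IBondY i → X) (U : B.Cfg) (c c' : IBondY i) :
    (siteKernelOfOp i B cfg (fun V => Ring.inverse (T V)) ix iy).ker U c c' ≤
      dimConstY b * ∑ f : Ff, ∑ f' : Ff, |(reMatY b (T (cfg U)))⁻¹ (ix c, f) (iy c', f')| := by
  have hS : 0 ≤ ∑ f : Ff, ∑ f' : Ff, |(reMatY b (T (cfg U)))⁻¹ (ix c, f) (iy c', f')| :=
    Finset.sum_nonneg fun _ _ => Finset.sum_nonneg fun _ _ => abs_nonneg _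
  change (⨆ E : BallY 𝔸, ‖(Ring.inverse (T (cfg U))) (deltaY (iy c') (E : 𝔸)) (ix c)‖) ≤ _
  refine iSup_ball_le (fun E => ?_) (mul_nonneg (dimConstY_nonneg b) hS)
  have hE : ‖(E : 𝔸)‖ ≤ 1 := mem_closedBall_zero_iff.mp E.2
  calc ‖(Ring.inverse (T (cfg U))) (deltaY (iy c') (E : 𝔸)) (ix c)‖
      ≤ dimConstY b * ‖(E : 𝔸)‖ * ∑ f : Ff, ∑ f' : Ff, |(reMatY b (T (cfg U)))⁻¹ (ix c, f) (iy c', f')| :=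
        norm_ringInverse_deltaY_le b _ _ _ _
    _ ≤ dimConstY b * 1 * ∑ f : Ff, ∑ f' : Ff, |(reMatY b (T (cfg U)))⁻¹ (ix c, f) (iy c', f')| := by
        gcongr
        exact dimConstY_nonneg b
    _ = _ := by rw [mul_one]

omit [DecidableEq Ff] in
/-- a sum over the fibre of `Prod.fst` is a sum over the basis index. [folklore] -/
private theorem sum_fiber_fst (g : X × Ff → ℝ) (y : X) :
    ∑ a ∈ Finset.univ.filter (fun a : X × Ff => a.1 = y), g a = ∑ f : Ff, g (y, f) := by
  rw [Finset.sum_filter, Fintype.sum_prod_type, Finset.sum_comm]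
  refine Finset.sum_congr rfl fun f _ => ?_
  rw [Finset.sum_ite_eq' Finset.univ y (fun x => g (x, f))]
  simp

omit [DecidableEq Ff] in
/-- the fibres of `Prod.fst` have `card Ff` elements. [folklore] -/
private theorem card_fiber_fst (y : X) : (Finset.univ.filter fun a : X × Ff => a.1 = y).card = Fintype.card Ff := by
  rw [show (Finset.univ.filter fun a : X × Ff => a.1 = y) = ({y} : Finset X) ×ˢ (Finset.univ : Finset Ff) by
    ext ⟨a, f⟩
    simp [eq_comm]]
  simp

/-- `κ′(b) := max(κ(b), 1) > 0`, the constant actually used to normalise. [cite: Balaban1985BackgroundPropagators, (3.132) p.422, bookkeeping] -/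
def dimConstY' : ℝ := max (dimConstY b) 1

omit [CompleteSpace 𝔸] [DecidableEq Ff] in
/-- `0 < κ′(b)`. [cite: Balaban1985BackgroundPropagators, (3.132) p.422, bookkeeping] -/
theorem dimConstY'_pos : 0 < dimConstY' b := lt_of_lt_of_le one_pos (le_max_right _ _)

/-- **THE NORMALISED REAL MATRIX OF A LETTER**: `S := diag(w∘fst ∕ κ′) · reMatY b T · diag(w∘fst)` — the written repair's
`S̃ = D⁻¹W^{1/2}(QGQ*)W^{1/2}D⁻¹` on `I = 𝔅 × basis(𝔤)` with the site weights `w` (`= (Lʲη)^{−(1+d′∕2)}` at the record) and the basis constant.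
It is the matrix about which the estimates (coercivity, decay) are HYPOTHESES downstream. [cite: Balaban1985BackgroundPropagators, (3.126) p.420 + (3.132) p.422 (dictionary)] -/
def normMatY (w : X → ℝ) (T : Module.End ℂ (X → 𝔸)) : Matrix (X × Ff) (X × Ff) ℝ :=
  Matrix.diagonal (fun a => w a.1 / dimConstY' b) * reMatY b T * Matrix.diagonal (fun a => w a.1)

omit [DecidableEq Ff] [DecidableEq X] in
/-- the inverse of an invertible real diagonal matrix. [folklore] -/
private theorem diagonal_inv_of_ne_zero {n : Type} [Fintype n] [DecidableEq n] (u : n → ℝ) (hu : ∀ a, u a ≠ 0) :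
    (Matrix.diagonal u)⁻¹ = Matrix.diagonal fun a => (u a)⁻¹ := by
  apply Matrix.inv_eq_left_inv
  rw [Matrix.diagonal_mul_diagonal, ← Matrix.diagonal_one]
  congr 1
  funext a
  exact inv_mul_cancel₀ (hu a)

omit [CompleteSpace 𝔸] in
/-- the entries of the inverse normalised matrix: `S⁻¹ a c = (w a.1)⁻¹ · (reMatY b T)⁻¹ a c · κ′∕(w c.1)` (unconditionally in `T`).
[cite: Balaban1985BackgroundPropagators, (3.132) p.422, bookkeeping] -/
theorem normMatY_inv_apply {w : X → ℝ} (hw : ∀ x, w x ≠ 0) (T : Module.End ℂ (X → 𝔸)) (a c : X × Ff) :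
    (normMatY b w T)⁻¹ a c = (w a.1)⁻¹ * (reMatY b T)⁻¹ a c * (dimConstY' b / w c.1) := by
  have h1 : ∀ a : X × Ff, w a.1 / dimConstY' b ≠ 0 := fun a => div_ne_zero (hw a.1) (dimConstY'_pos b).ne'
  have h2 : ∀ a : X × Ff, w a.1 ≠ 0 := fun a => hw a.1
  unfold normMatY
  rw [Matrix.mul_inv_rev, Matrix.mul_inv_rev, diagonal_inv_of_ne_zero _ h1, diagonal_inv_of_ne_zero _ h2,
    Matrix.diagonal_mul, Matrix.mul_diagonal, inv_div]
  ring

/-- ★ **THE BLOCKWISE DICTIONARY IS A THEOREM FOR INVERSE LETTERS**: for EVERY letter family `T : CfgY → End_ℂ(𝔅-functions)` and all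
positive site weights `w`, def-Y's (3.132) reading of `U ↦ Ring.inverse (T U)` at the index bonds satisfies g3's `InvNormalisedIdx` over the
basis fibration `Prod.fst : 𝔅 × Ff → 𝔅` with the normalised real matrix `normMatY b w (T (cfg U))` — no hypothesis on `T` (non-units read `0`).
(Instances on the coarse sites `(geo9K i).Site` are the caller's, as the N06 knit binds them.)
[cite: Balaban1985BackgroundPropagators, (3.132) p.422 + (3.126) p.420 (the operator (QGQ*)⁻¹; dictionary discharged)] -/
theorem invNormalisedIdx_of_ringInverse (i : KIdx d ℓ hd hL b₀ b₁) (B : B9.Backgrounds) (cfg : B.Cfg → CfgY 𝔸 i)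
    [instF : Fintype (B9GeoNormsKLevelV1.geo9K i).Site] [instD : DecidableEq (B9GeoNormsKLevelV1.geo9K i).Site]
    (T : CfgY 𝔸 i → Module.End ℂ ((B9GeoNormsKLevelV1.geo9K i).Site → 𝔸)) {w : (B9GeoNormsKLevelV1.geo9K i).Site → ℝ}
    (hw : ∀ y, 0 < w y) :
    InvNormalisedIdx (siteKernelOfOp i B cfg (fun V => Ring.inverse (T V)) id id)
      (Prod.fst : (B9GeoNormsKLevelV1.geo9K i).Site × Ff → (B9GeoNormsKLevelV1.geo9K i).Site)
      (fun U => normMatY b w (T (cfg U))) w := by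
  intro U y y'
  have hw0 : ∀ x, w x ≠ 0 := fun x => (hw x).ne'
  have habs : |(siteKernelOfOp i B cfg (fun V => Ring.inverse (T V)) id id).ker U y y'| =
      (siteKernelOfOp i B cfg (fun V => Ring.inverse (T V)) id id).ker U y y' :=
    abs_of_nonneg (siteKernelOfOp_ker_nonneg i B cfg (fun V => Ring.inverse (T V)) id id U y y')
  have hR : w y * w y' * ∑ a ∈ Finset.univ.filter (fun a : (B9GeoNormsKLevelV1.geo9K i).Site × Ff => a.1 = y),
      ∑ c ∈ Finset.univ.filter (fun c : (B9GeoNormsKLevelV1.geo9K i).Site × Ff => c.1 = y'),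
        |(normMatY b w (T (cfg U)))⁻¹ a c| =
      dimConstY' b * ∑ f : Ff, ∑ f' : Ff, |(reMatY b (T (cfg U)))⁻¹ (y, f) (y', f')| := by
    rw [Finset.sum_congr rfl fun a _ => sum_fiber_fst (fun c => |(normMatY b w (T (cfg U)))⁻¹ a c|) y',
      sum_fiber_fst (fun a => ∑ f' : Ff, |(normMatY b w (T (cfg U)))⁻¹ a (y', f')|) y]
    have hterm : ∀ f f' : Ff, |(normMatY b w (T (cfg U)))⁻¹ (y, f) (y', f')| =
        (w y)⁻¹ * (dimConstY' b / w y') * |(reMatY b (T (cfg U)))⁻¹ (y, f) (y', f')| := by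
      intro f f'
      rw [normMatY_inv_apply b hw0, abs_mul, abs_mul, abs_of_pos (inv_pos.mpr (hw y)),
        abs_of_pos (div_pos (dimConstY'_pos b) (hw y'))]
      ring
    simp_rw [hterm, ← Finset.mul_sum]
    have hy : w y ≠ 0 := hw0 y
    have hy' : w y' ≠ 0 := hw0 y'
    field_simp
  refine habs.trans_le (le_of_le_of_eq ?_ hR.symm)
  exact (siteKernelOfOp_ker_ringInverse_le b i B cfg T id id U y y').trans
    (mul_le_mul_of_nonneg_right (le_max_left _ _)
      (Finset.sum_nonneg fun _ _ => Finset.sum_nonneg fun _ _ => abs_nonneg _))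

end Reading

/-! ## §4 Row 26 at the record geometry for inverse letters: the four estimate binders only -/

section Record

open B6KLevelCensusIndexV1 (KIdx)
open B9PinMembersKLevelV1 (MemberY geo9Y bg9Y)
open B9GeoLemma21KLevelV1 (geo9Y_len_pos)
open B9Eq3132CTInputs (CoerciveUnder DecayUnder)
open B9Eq3132ScalarIndex (geoComap InvNormalisedIdx stmt3132Printed_geo9Y_of_coercive_decay_idx)

variable {d ℓ : ℕ} {hd : 1 ≤ d + 1} {hL : Odd (ℓ + 1) ∧ 1 < ℓ + 1} {b₀ b₁ : ℝ} {Mstar : ℕ}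
variable {𝔸 : Type} [NormedRing 𝔸] [NormedAlgebra ℂ 𝔸] [CompleteSpace 𝔸] (G : Subgroup 𝔸ˣ)
variable {Ff : Type} [Fintype Ff] [DecidableEq Ff] (b : Module.Basis Ff ℝ 𝔸)

/-- ★ **ROW 26 AT THE RECORD GEOMETRY FOR INVERSE LETTERS, FROM THE FOUR ESTIMATE BINDERS ONLY**: over the members `MemberY` with
their realised geometry `geo9Y` and backgrounds `bg9Y 𝔸 G` (any `𝔸`, `G`, any real basis `b` of `𝔸`, instances as the knit binds them),
for ANY two letter families `T x, T₁ x : CfgY → End_ℂ(𝔅-functions)` (def-Y v2: `(QGQ*)(U)`, `(QG₁Q*)(U)`), coercivity and decay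
(`CoerciveUnder`∕`DecayUnder`, the Thm-3.12-prefix shapes of `B9Eq3132CTInputs`) of the NORMALISED REAL MATRICES
`normMatY b w (T x U)` on the index `𝔅 × Ff` with the symmetric weights `w(y) = (Lʲη)^{−(1+d′∕2)}` give the whole printed leaf
`B9.Stmt3132Printed d′ c35 geo9Y (bg9Y 𝔸 G)` for the (3.132) READINGS of the inverse letters `U ↦ Ring.inverse (T x U)`, `U ↦ Ring.inverse (T₁ x U)`.
The dictionaries `hN hN₁` of g3's `stmt3132Printed_geo9Y_of_coercive_decay_idx` are DISCHARGED (§3), `π := Prod.fst`, `F := card Ff`.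
Honest: the estimates remain hypotheses (located: Thm 3.11 p.416 ∕ Thm 3.3 p.399 + [4] (2.60)); nothing of print asserted; NOT a node discharge.
[cite: Balaban1985BackgroundPropagators, (3.132) p.422 + Thm 3.12 p.423 (prefix); Balaban1984PropagatorsII, Lemma 2.1 (2.60)–(2.61) p.234] -/
theorem stmt3132Printed_geo9Y_of_ringInverse (dd : ℕ) [∀ x : MemberY d ℓ hd hL b₀ b₁ Mstar, Fintype (geo9Y x).Site]
    [∀ x : MemberY d ℓ hd hL b₀ b₁ Mstar, DecidableEq (geo9Y x).Site] {c35 : ℝ}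
    (T T₁ : ∀ x : MemberY d ℓ hd hL b₀ b₁ Mstar, CfgY 𝔸 x.toKIdx → Module.End ℂ ((geo9Y x).Site → 𝔸))
    (hco : CoerciveUnder c35 (fun x => geoComap (geo9Y x) (Prod.fst : (geo9Y x).Site × Ff → (geo9Y x).Site)) (bg9Y 𝔸 G)
      (fun x U => normMatY b (fun y => (geo9Y x).len y ^ (-(1 + (dd : ℝ) / 2))) (T x U)))
    (hdec : DecayUnder c35 (fun x => geoComap (geo9Y x) (Prod.fst : (geo9Y x).Site × Ff → (geo9Y x).Site)) (bg9Y 𝔸 G)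
      (fun x U => normMatY b (fun y => (geo9Y x).len y ^ (-(1 + (dd : ℝ) / 2))) (T x U)))
    (hco₁ : CoerciveUnder c35 (fun x => geoComap (geo9Y x) (Prod.fst : (geo9Y x).Site × Ff → (geo9Y x).Site)) (bg9Y 𝔸 G)
      (fun x U => normMatY b (fun y => (geo9Y x).len y ^ (-(1 + (dd : ℝ) / 2))) (T₁ x U)))
    (hdec₁ : DecayUnder c35 (fun x => geoComap (geo9Y x) (Prod.fst : (geo9Y x).Site × Ff → (geo9Y x).Site)) (bg9Y 𝔸 G)
      (fun x U => normMatY b (fun y => (geo9Y x).len y ^ (-(1 + (dd : ℝ) / 2))) (T₁ x U))) :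
    B9.Stmt3132Printed dd c35 (geo9Y (d := d) (ℓ := ℓ) (hd := hd) (hL := hL) (b₀ := b₀) (b₁ := b₁) (Mstar := Mstar))
      (bg9Y 𝔸 G)
      (fun x => siteKernelOfOp x.toKIdx (bg9Y 𝔸 G x) (fun U => U) (fun U => Ring.inverse (T x U)) id id)
      (fun x => siteKernelOfOp x.toKIdx (bg9Y 𝔸 G x) (fun U => U) (fun U => Ring.inverse (T₁ x U)) id id) := by
  have hF : ∀ (x : MemberY d ℓ hd hL b₀ b₁ Mstar) (y : (geo9Y x).Site),
      (((Finset.univ.filter fun a : (geo9Y x).Site × Ff => a.1 = y).card : ℕ) : ℝ) ≤ (Fintype.card Ff : ℝ) :=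
    fun x y => by rw [card_fiber_fst]
  have hw : ∀ (x : MemberY d ℓ hd hL b₀ b₁ Mstar) (y : (geo9Y x).Site), 0 < (geo9Y x).len y ^ (-(1 + (dd : ℝ) / 2)) :=
    fun x y => Real.rpow_pos_of_pos (geo9Y_len_pos x y) _
  -- the dictionaries, with the knit's instances on `(geo9Y x).Site` (the same type as `(geo9K x.toKIdx).Site`)
  have hN : ∀ x : MemberY d ℓ hd hL b₀ b₁ Mstar,
      InvNormalisedIdx (g := geo9Y x)
        (siteKernelOfOp x.toKIdx (bg9Y 𝔸 G x) (fun U => U) (fun U => Ring.inverse (T x U)) id id)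
        (Prod.fst : (geo9Y x).Site × Ff → (geo9Y x).Site)
        (fun U => normMatY b (fun y => (geo9Y x).len y ^ (-(1 + (dd : ℝ) / 2))) (T x U))
        (fun y => (geo9Y x).len y ^ (-(1 + (dd : ℝ) / 2))) :=
    fun x => invNormalisedIdx_of_ringInverse b x.toKIdx (bg9Y 𝔸 G x) (fun U => U)
      (instF := (inferInstance : Fintype (geo9Y x).Site)) (instD := (inferInstance : DecidableEq (geo9Y x).Site)) (T x) (hw x)
  have hN₁ : ∀ x : MemberY d ℓ hd hL b₀ b₁ Mstar,
      InvNormalisedIdx (g := geo9Y x)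
        (siteKernelOfOp x.toKIdx (bg9Y 𝔸 G x) (fun U => U) (fun U => Ring.inverse (T₁ x U)) id id)
        (Prod.fst : (geo9Y x).Site × Ff → (geo9Y x).Site)
        (fun U => normMatY b (fun y => (geo9Y x).len y ^ (-(1 + (dd : ℝ) / 2))) (T₁ x U))
        (fun y => (geo9Y x).len y ^ (-(1 + (dd : ℝ) / 2))) :=
    fun x => invNormalisedIdx_of_ringInverse b x.toKIdx (bg9Y 𝔸 G x) (fun U => U)
      (instF := (inferInstance : Fintype (geo9Y x).Site)) (instD := (inferInstance : DecidableEq (geo9Y x).Site)) (T₁ x) (hw x)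
  exact stmt3132Printed_geo9Y_of_coercive_decay_idx dd (fun x => (Prod.fst : (geo9Y x).Site × Ff → (geo9Y x).Site)) hF
    hco hdec hco₁ hdec₁ hN hN₁

end Record

/-! ## §5 Row 26 at `opsYOfLetters` for letters of the form `U ↦ Ring.inverse (T U)` -/

section OpsY

open Node00 (opsYOfLetters LettersY ExpsY Stage3Params)
open B9PinMembersKLevelV1 (MemberY geo9Y bg9Y)
open B7Prop2SpecialUnitary (specialUnitaryUnits)
open B9Eq3132CTInputs (CoerciveUnder DecayUnder)
open B9Eq3132ScalarIndex (geoComap)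
open scoped Matrix.Norms.L2Operator

variable {N : ℕ}

/-- ★ **ROW 26 OF THE N06 KNIT AT def-Y's INSTANCE, FOR INVERSE LETTERS**: at `ops := opsYOfLetters N θ M⋆ 𝔏 𝔈`, if the two letters
`(𝔏 x).QGQinv`, `(𝔏 x).QG1Qinv` ARE inverse letters `U ↦ Ring.inverse (T x U)`, `U ↦ Ring.inverse (T₁ x U)` (def-Y v2's construction
of `(QGQ*)⁻¹(U)`, `(QG₁Q*)⁻¹(U)`; for v1's arbitrary `𝔏` a displayed hypothesis `hT hT₁`), then the knit's `s3132 : B9.Stmt3132Printed d′ c35 geo9Y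
(bg9Y …) (fun x => (ops x).QGQinv) (fun x => (ops x).QG1Qinv)` follows from the FOUR ESTIMATE BINDERS on the normalised real matrices
(§4) — the dictionary binders `hN32 hN32₁` (`InvNormalised`∕`InvNormalisedIdx`), `π`, `hF`, `hA32`, `hwt` of the earlier displays are gone.
Any real basis `b` of `M_N(ℂ)` (e.g. `Module.finBasis ℝ _`).  Honest: estimates remain hypotheses; nothing of print asserted; NOT a node discharge.
[cite: Balaban1985BackgroundPropagators, (3.132) p.422 + Thm 3.12 p.423 (prefix); Balaban1984PropagatorsII, Lemma 2.1 (2.60)–(2.61) p.234] -/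
theorem stmt3132Printed_opsYOfLetters_of_ringInverse (θ : Stage3Params) (Mstar : ℕ) (𝔏 : LettersY N θ Mstar) (𝔈 : ExpsY N θ Mstar)
    (dd : ℕ) [∀ x : MemberY θ.d₆ θ.ℓ₆ θ.hd' θ.hL' θ.b₀ θ.b₁ Mstar, Fintype (geo9Y x).Site]
    [∀ x : MemberY θ.d₆ θ.ℓ₆ θ.hd' θ.hL' θ.b₀ θ.b₁ Mstar, DecidableEq (geo9Y x).Site] {c35 : ℝ}
    {Ff : Type} [Fintype Ff] [DecidableEq Ff] (b : Module.Basis Ff ℝ (Matrix (Fin N) (Fin N) ℂ))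
    (T T₁ : ∀ x : MemberY θ.d₆ θ.ℓ₆ θ.hd' θ.hL' θ.b₀ θ.b₁ Mstar,
      Node00.CfgY (Matrix (Fin N) (Fin N) ℂ) x.toKIdx → Module.End ℂ ((geo9Y x).Site → Matrix (Fin N) (Fin N) ℂ))
    (hT : ∀ (x : MemberY θ.d₆ θ.ℓ₆ θ.hd' θ.hL' θ.b₀ θ.b₁ Mstar) (U : Node00.CfgY (Matrix (Fin N) (Fin N) ℂ) x.toKIdx),
      (𝔏 x).QGQinv U = Ring.inverse (T x U))
    (hT₁ : ∀ (x : MemberY θ.d₆ θ.ℓ₆ θ.hd' θ.hL' θ.b₀ θ.b₁ Mstar) (U : Node00.CfgY (Matrix (Fin N) (Fin N) ℂ) x.toKIdx),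
      (𝔏 x).QG1Qinv U = Ring.inverse (T₁ x U))
    (hco : CoerciveUnder c35 (fun x => geoComap (geo9Y x) (Prod.fst : (geo9Y x).Site × Ff → (geo9Y x).Site))
      (bg9Y (Matrix (Fin N) (Fin N) ℂ) (specialUnitaryUnits (Fin N)))
      (fun x U => normMatY b (fun y => (geo9Y x).len y ^ (-(1 + (dd : ℝ) / 2))) (T x U)))
    (hdec : DecayUnder c35 (fun x => geoComap (geo9Y x) (Prod.fst : (geo9Y x).Site × Ff → (geo9Y x).Site))
      (bg9Y (Matrix (Fin N) (Fin N) ℂ) (specialUnitaryUnits (Fin N)))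
      (fun x U => normMatY b (fun y => (geo9Y x).len y ^ (-(1 + (dd : ℝ) / 2))) (T x U)))
    (hco₁ : CoerciveUnder c35 (fun x => geoComap (geo9Y x) (Prod.fst : (geo9Y x).Site × Ff → (geo9Y x).Site))
      (bg9Y (Matrix (Fin N) (Fin N) ℂ) (specialUnitaryUnits (Fin N)))
      (fun x U => normMatY b (fun y => (geo9Y x).len y ^ (-(1 + (dd : ℝ) / 2))) (T₁ x U)))
    (hdec₁ : DecayUnder c35 (fun x => geoComap (geo9Y x) (Prod.fst : (geo9Y x).Site × Ff → (geo9Y x).Site))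
      (bg9Y (Matrix (Fin N) (Fin N) ℂ) (specialUnitaryUnits (Fin N)))
      (fun x U => normMatY b (fun y => (geo9Y x).len y ^ (-(1 + (dd : ℝ) / 2))) (T₁ x U))) :
    B9.Stmt3132Printed dd c35 (geo9Y (d := θ.d₆) (ℓ := θ.ℓ₆) (hd := θ.hd') (hL := θ.hL') (b₀ := θ.b₀) (b₁ := θ.b₁) (Mstar := Mstar))
      (bg9Y (Matrix (Fin N) (Fin N) ℂ) (specialUnitaryUnits (Fin N)))
      (fun x => (opsYOfLetters N θ Mstar 𝔏 𝔈 x).QGQinv) (fun x => (opsYOfLetters N θ Mstar 𝔏 𝔈 x).QG1Qinv) := by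
  have e : (fun x => (opsYOfLetters N θ Mstar 𝔏 𝔈 x).QGQinv) = fun x : MemberY θ.d₆ θ.ℓ₆ θ.hd' θ.hL' θ.b₀ θ.b₁ Mstar =>
      siteKernelOfOp x.toKIdx (bg9Y (Matrix (Fin N) (Fin N) ℂ) (specialUnitaryUnits (Fin N)) x) (fun U => U)
        (fun U => Ring.inverse (T x U)) id id := by
    funext x
    have h : (𝔏 x).QGQinv = fun U => Ring.inverse (T x U) := funext (hT x)
    show siteKernelOfOp x.toKIdx (bg9Y (Matrix (Fin N) (Fin N) ℂ) (specialUnitaryUnits (Fin N)) x) (fun U => U)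
      (𝔏 x).QGQinv id id = _
    rw [h]
    rfl
  have e₁ : (fun x => (opsYOfLetters N θ Mstar 𝔏 𝔈 x).QG1Qinv) = fun x : MemberY θ.d₆ θ.ℓ₆ θ.hd' θ.hL' θ.b₀ θ.b₁ Mstar =>
      siteKernelOfOp x.toKIdx (bg9Y (Matrix (Fin N) (Fin N) ℂ) (specialUnitaryUnits (Fin N)) x) (fun U => U)
        (fun U => Ring.inverse (T₁ x U)) id id := by
    funext x
    have h : (𝔏 x).QG1Qinv = fun U => Ring.inverse (T₁ x U) := funext (hT₁ x)
    show siteKernelOfOp x.toKIdx (bg9Y (Matrix (Fin N) (Fin N) ℂ) (specialUnitaryUnits (Fin N)) x) (fun U => U)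
      (𝔏 x).QG1Qinv id id = _
    rw [h]
    rfl
  rw [e, e₁]
  exact stmt3132Printed_geo9Y_of_ringInverse (specialUnitaryUnits (Fin N)) b dd T T₁ hco hdec hco₁ hdec₁

end OpsY

end

end Literature.MathematicalPhysics.QuantumFieldTheory.Balaban1983to89.B9Eq3132RingInverseReading
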